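import Literature.AlgebraicGeometry.Morphisms.EtaleLiftDualNumber
import Literature.AlgebraicGeometry.Motives.DualNumberPoints
import Literature.AlgebraicGeometry.Motives.AbelianVarietyIsogenyEtale
import Literature.AlgebraicGeometry.Motives.AbelianVarietyDualQuotient
import HarnessLib

/-!
# `ℂ[ε]`-points lift along étale `ℂ`-morphisms, along isogenies, and along `φ_Θ : A → Â`

Topic `Literature/AlgebraicGeometry/Motives`; theorems only (no definition, no named fact, no
instance).  The `SchemeOver ℂ` / `dualNumberOver` packaging of the infinitesimal lifting property of
étale morphisms (`Morphisms/EtaleLiftDualNumber`): for a morphism `f : X ⟶ Y` of `ℂ`-schemes whose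
underlying map is étale,

* `exists_unique_lift_dualNumberOver_of_etale` — a `ℂ[ε]`-point `u : dualNumberOver ⟶ Y` lifts
  UNIQUELY through any prescribed complex point `x` of `X` above the closed point of `u`
  ([GortzWedhorn2020] (6.4), Prop. 6.7: the tangent map `T_x X → T_{f x} Y` of an étale morphism
  is bijective);
* `exists_lift_dualNumberOver_of_etale` — hence, if `f` is onto on complex points, EVERY
  `ℂ[ε]`-point of `Y` lifts to `X`;
* `AbelianVariety.exists_unique_lift_dualNumberOver_of_isIsogeny`,
  `AbelianVariety.exists_lift_dualNumberOver_of_isIsogeny` — the case of an isogeny of complex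
  abelian varieties (étale in characteristic `0`, ★ `IsIsogeny.etale`; onto on `ℂ`-points,
  ★ `AlgPoints.map_surjective_of_surjective`);
* `AbelianVariety.exists_lift_dualNumber_phiTheta` — the case `φ_Θ : A → Â = A/K(Θ)`
  (★ `isIsogeny_phiTheta`): every `ℂ[ε]`-point of `Â` lifts along `φ_Θ` (the text of the M13
  programme's socket `socket_N3d_r1_etaleLift`, with the tree token `dualNumberOver`).

## References
* [GortzWedhorn2020] U. Görtz, T. Wedhorn, *Algebraic Geometry I*, 2nd ed. (2020), (6.4) and
  Prop. 6.7 (p. 152) (tangent spaces as `k[ε]`-valued points).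
* [GortzWedhorn2023] U. Görtz, T. Wedhorn, *Algebraic Geometry II* (2023), Def. 18.3 and
  Def. 18.34 (formally étale, étale), Prop. 27.187 (isogenies `[n]` étale for `n` invertible).
* [MumfordAV1970] D. Mumford, *Abelian Varieties*, §7 Thm. 4 (p. 72) (separable isogenies).
* [MilneAV2008] J. Milne, *Abelian Varieties* (v2.00, 2008), I §8 Prop. 8.14 (p. 39) (`φ_Θ`).
-/

noncomputable section

open CategoryTheory AlgebraicGeometry
open scoped DualNumber

universe u

namespace Literature.AlgebraicGeometry.Motives

open AbelianVariety (dualNumberOver)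

/-! ### §1 Étale `ℂ`-morphisms -/

section Etale

variable {X Y : SchemeOver ℂ} (f : X ⟶ Y)

/-- `Spec ℂ → Spec ℂ[ε] → Spec ℂ` is `Spec (algebraMap ℂ ℂ)`: the closed point of the dual numbers is
a `ℂ`-morphism from `specOver ℂ ℂ` (plumbing). [folklore] -/
private theorem specMap_fstHom_comp_algebraMap :
    Spec.map (CommRingCat.ofHom (TrivSqZeroExt.fstHom ℂ ℂ ℂ).toRingHom) ≫
        Spec.map (CommRingCat.ofHom (algebraMap ℂ ℂ[ε])) =
      Spec.map (CommRingCat.ofHom (algebraMap ℂ ℂ)) := by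
  rw [← Spec.map_comp, ← CommRingCat.ofHom_comp]
  exact congrArg (fun g : ℂ →+* ℂ => Spec.map (CommRingCat.ofHom g))
    (RingHom.ext fun z => TrivSqZeroExt.fst_inl ℂ z)

/-- **A `ℂ[ε]`-point lifts uniquely along an étale `ℂ`-morphism through a prescribed complex point**:
for `f : X ⟶ Y` over `ℂ` with `f` étale, `u : Spec ℂ[ε] → Y` over `ℂ` and a complex point `x` of `X`
with `f ∘ x =` the closed point of `u`, there is a unique `w : Spec ℂ[ε] → X` over `ℂ` through `x`
with `f ∘ w = u` (the tangent map of an étale morphism at a rational point is bijective,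
[GortzWedhorn2020] (6.4)/Prop. 6.7; `Morphisms.exists_unique_lift_dualNumber_of_etale` repackaged in
`Over (Spec ℂ)`). [cite: GortzWedhorn2020, (6.4) and Prop. 6.7 (p. 152)]
[cite: GortzWedhorn2023, Def. 18.3 and Def. 18.34] -/
theorem exists_unique_lift_dualNumberOver_of_etale [Etale f.left] (u : dualNumberOver ⟶ Y)
    (x : AlgPoints X ℂ)
    (hx : x.left ≫ f.left =
      Spec.map (CommRingCat.ofHom (TrivSqZeroExt.fstHom ℂ ℂ ℂ).toRingHom) ≫ u.left) :
    ∃! w : dualNumberOver ⟶ X,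
      Spec.map (CommRingCat.ofHom (TrivSqZeroExt.fstHom ℂ ℂ ℂ).toRingHom) ≫ w.left = x.left ∧
        w ≫ f = u := by
  obtain ⟨w, ⟨hw₁, hw₂⟩, hu⟩ :=
    Morphisms.exists_unique_lift_dualNumber_of_etale f.left u.left x.left hx
  have hw : w ≫ X.hom = Spec.map (CommRingCat.ofHom (algebraMap ℂ ℂ[ε])) := by
    rw [← Over.w f, ← Category.assoc, hw₂]
    exact Over.w u
  refine ⟨Over.homMk w hw, ⟨hw₁, Over.OverMorphism.ext hw₂⟩, ?_⟩
  rintro w' ⟨h₁, h₂⟩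
  exact Over.OverMorphism.ext (hu w'.left ⟨h₁, congrArg CommaMorphism.left h₂⟩)

/-- **Every `ℂ[ε]`-point lifts along an étale `ℂ`-morphism that is onto on complex points**: lift the
closed point first (`hf`), then apply `exists_unique_lift_dualNumberOver_of_etale`.
[cite: GortzWedhorn2020, (6.4) and Prop. 6.7 (p. 152)] [cite: GortzWedhorn2023, Def. 18.3 and Def. 18.34] -/
theorem exists_lift_dualNumberOver_of_etale [Etale f.left]
    (hf : Function.Surjective (AlgPoints.map (L := ℂ) f)) (u : dualNumberOver ⟶ Y) :
    ∃ w : dualNumberOver ⟶ X, w ≫ f = u := by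
  let pt : specOver ℂ ℂ ⟶ dualNumberOver :=
    Over.homMk (Spec.map (CommRingCat.ofHom (TrivSqZeroExt.fstHom ℂ ℂ ℂ).toRingHom))
      specMap_fstHom_comp_algebraMap
  obtain ⟨x, hx⟩ := hf (pt ≫ u)
  obtain ⟨w, ⟨-, hw⟩, -⟩ :=
    exists_unique_lift_dualNumberOver_of_etale f u x (congrArg CommaMorphism.left hx)
  exact ⟨w, hw⟩

end Etale

/-! ### §2 Isogenies of complex abelian varieties -/

namespace AbelianVariety

variable {A B : AbelianVariety ℂ} {φ : A ⟶ B}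

/-- **`ℂ[ε]`-points lift uniquely along an isogeny through a prescribed complex point** (an isogeny
of complex abelian varieties is étale, ★ `IsIsogeny.etale`, so its tangent maps are bijective).
[cite: MumfordAV1970, §7 Thm. 4 (p. 72)] [cite: GortzWedhorn2020, (6.4) and Prop. 6.7 (p. 152)] -/
theorem exists_unique_lift_dualNumberOver_of_isIsogeny (hφ : IsIsogeny φ)
    (u : dualNumberOver ⟶ B.X) (a : AlgPoints A.X ℂ)
    (ha : a.left ≫ Hom.toSchemeHom φ =
      Spec.map (CommRingCat.ofHom (TrivSqZeroExt.fstHom ℂ ℂ ℂ).toRingHom) ≫ u.left) :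
    ∃! w : dualNumberOver ⟶ A.X,
      Spec.map (CommRingCat.ofHom (TrivSqZeroExt.fstHom ℂ ℂ ℂ).toRingHom) ≫ w.left = a.left ∧
        w ≫ φ.hom.hom.hom = u := by
  haveI : Etale φ.hom.hom.hom.left := hφ.etale
  exact exists_unique_lift_dualNumberOver_of_etale φ.hom.hom.hom u a ha

/-- **Every `ℂ[ε]`-point of `B` lifts along an isogeny `φ : A → B` of complex abelian varieties**
(`φ` is étale and onto on complex points). [cite: MumfordAV1970, §7 Thm. 4 (p. 72)]
[cite: GortzWedhorn2020, (6.4) and Prop. 6.7 (p. 152)] -/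
theorem exists_lift_dualNumberOver_of_isIsogeny (hφ : IsIsogeny φ) (u : dualNumberOver ⟶ B.X) :
    ∃ w : dualNumberOver ⟶ A.X, w ≫ φ.hom.hom.hom = u := by
  haveI : Etale φ.hom.hom.hom.left := hφ.etale
  haveI : Surjective φ.hom.hom.hom.left := hφ.1
  exact exists_lift_dualNumberOver_of_etale φ.hom.hom.hom
    (AlgPoints.map_surjective_of_surjective _) u

/-! ### §3 `φ_Θ : A → Â` -/

/-- **Every `ℂ[ε]`-point of `Â = A/K(Θ)` lifts along `φ_Θ` to a `ℂ[ε]`-point of `A`** (`φ_Θ` is an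
isogeny, ★ `isIsogeny_phiTheta`; Milne I Prop. 8.14).  This is the text of the M13 programme's socket
`socket_N3d_r1_etaleLift A₀ hΘ` with the tree token `dualNumberOver`.
[cite: MilneAV2008, I §8 Prop. 8.14 (p. 39)] [cite: MumfordAV1970, §7 Thm. 4 (p. 72)] -/
theorem exists_lift_dualNumber_phiTheta (A₀ : AbelianVariety ℂ) {Θ : CartierDivisor A₀.X.left}
    (hΘ : Θ.IsAmple) (u₂ : dualNumberOver ⟶ (A₀.dualOf Θ hΘ).X) :
    ∃ w : dualNumberOver ⟶ A₀.X, w ≫ (A₀.phiTheta Θ hΘ).hom.hom.hom = u₂ :=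
  exists_lift_dualNumberOver_of_isIsogeny (A₀.isIsogeny_phiTheta hΘ) u₂

end AbelianVariety

end Literature.AlgebraicGeometry.Motives

end
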